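import Summits.CriticalPhenomena.Ising3DConformalLimit.Theorems.HyperoctahedralRPExistsScaleCovariantLimitFoldedCurrentDefs
import Literature.Probability.LatticeModels.AizenmanGrahamInequalityProofs
import Literature.Probability.LatticeModels.MeanFieldBoundGHS
import HarnessLib

/-!
# F1 `stub_foldedIdentity` — Aizenman's folded random-current identity on the box
# (crux `ExistsScaleCovariantLimit`, item stmt-CriticalPhenomena-1981, line `folded-current-repulsion`)

Route `HyperoctahedralRP` / `GaussianScaleMixture` (sub-problem `CriticalPhenomena/Ising3DConformalLimit`), crux
`Summit.CriticalPhenomena.Ising3DConformalLimit.Theses.HyperoctahedralRP.ExistsScaleCovariantLimit` (item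
stmt-CriticalPhenomena-1981). This file proves the registered stub `stub_foldedIdentity : FoldedIdentity` of the checked
skeleton `Cruxes/ExistsScaleCovariantLimit/Lines/folded_current_repulsion.lean`, whose statement lives in the landed
definitions module `Theorems/HyperoctahedralRPExistsScaleCovariantLimitFoldedCurrentDefs.lean`:

for `β ≥ 0` and sites `x, y ∈ Λ_L = {−L,…,L}³` strictly on the negative side of the mirror plane `𝕏 = {x₀ = 0}`,

  `⟨σ_x σ_{θy}⟩^∅_{Λ_L,β} = ⟨σ_x σ_y⟩^∅_{Λ_L,β} · P^{xy}_{Λ_L,β}[y ⟷ 𝕏 in n + θ(n)]`,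

`θ : x₀ ↦ −x₀` the site mirror (M. Aizenman, *Geometric analysis of Ising models, Part III*, arXiv:2509.02850,
Thm 14.2 with Lemma 14.3; the reflection-adapted switching lemma is Duminil-Copin–Panis, CMP 406 (2025), Lemma 2.3).

## Proof

Everything is assembled from the tree. Write `Z(A) = currentZ (zdGraph 3) Λ_L β ℰ_{Λ_L} A` for the generating function
of currents on the bonds of the box with sources `A`, and `h = isFoldable_box L` for the fold datum of the box.

1. *Inserting the indicator for free* (`currentZ_eq_tsum_connFix`): a current `n` with sources `{x} ∆ {θy}` has, after
   reflection, sources `{θx} ∆ {y}`, whose only source in the strict left half `H₋` is `y`; by the handshake for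
   reflected currents (`IsFoldable.connFix_fold_of_sources`) `y` is joined to `𝕏` in `fold (θ^* n) = fold n`
   (`fold_creflect`). Hence `Z({x} ∆ {θy}) = Z^{{x} ∆ {θy}}[y ⟷ 𝕏 in fold n]`.
2. *Switching at `y`* (`IsFoldable.tsum_switch_reflected_eq`, DCP 2025 Lemma 2.3):
   `Z^{{x} ∆ {θy}}[y ⟷ 𝕏] = Z^{{x} ∆ {θy} ∆ {y} ∆ {θy}}[y ⟷ 𝕏] = Z^{{x} ∆ {y}}[y ⟷ 𝕏] = foldHitZ L β x y`
   (`currentZ_singleton_symmDiff_reflect_eq`).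
3. *Random-current representation* `⟨σ_A⟩^∅_{Λ} = Z(A)/Z(∅)` (`isingCorr_free_eq_currentZ_div`) on both sides and the
   algebra `F/Z(∅) = (Z^{xy}/Z(∅)) · (F/Z^{xy})` (`div_eq_div_mul_div_of_le`, with `F ≤ Z^{xy}` covering the junk case
   `Z^{xy} = 0`).

References: M. Aizenman, Math. Phys. Anal. Geom. 28 (2025) 32 = arXiv:2509.02850, Thm 14.2, Lemma 14.3
[Aizenman2025GeometricIII]; H. Duminil-Copin, R. Panis, CMP 406 (2025) = arXiv:2404.05700, Lemma 2.3 and proof of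
Lemma 2.4 [DuminilCopinPanis2025LowerBounds].
-/

noncomputable section

namespace Summit.CriticalPhenomena.Ising3DConformalLimit.Cruxes.ExistsScaleCovariantLimit.FoldedCurrentRepulsion

open Finset
open scoped BigOperators symmDiff ENNReal
open Literature.Probability.LatticeModels
open Classical

/-! ## Part A. Two lemmas on an abstract fold datum -/

section FoldDatum

variable {V : Type*} [DecidableEq V] {G : SimpleGraph V} [G.LocallyFinite] {θ : V ≃ V} {Λ Hm : Finset V}

/-- The fold of the reflected current is the fold of the current: `fold (θ^* n) = fold n` (on a left edge `e`,
`n(θe) + n(θθe) = n(e) + n(θe)`; off the left edges both vanish). [folklore] -/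
theorem fold_creflect (h : IsFoldable G θ Λ Hm) (n : edgesIn G Λ → ℕ) : h.fold (h.creflect n) = h.fold n := by
  funext e
  simp only [IsFoldable.fold, IsFoldable.creflect, h.edgeRefl_edgeRefl]
  by_cases hl : IsLeft Hm (e : Sym2 V)
  · rw [if_pos hl, if_pos hl, add_comm]
  · rw [if_neg hl, if_neg hl]

/-- **Sources `{x, θu}` force `u ⟷ 𝕏` in the folded current** (Aizenman 2025, proof of Thm 14.2: "the second condition
is automatically satisfied"): if `x, u ∈ H₋` and `∂n = {x} ∆ {θu}`, then the reflected current `θ^* n` has sources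
`{θx} ∆ {u}`, whose only source in `H₋` is `u`; by the handshake for reflected currents `u` is joined to a fixed vertex in
`fold (θ^* n) = fold n`. [cite: DuminilCopinPanis2025LowerBounds, Lemma 2.4 (proof)] -/
theorem connFix_fold_of_csources_eq (h : IsFoldable G θ Λ Hm) {n : edgesIn G Λ → ℕ} {x u : V} (hx : x ∈ Hm)
    (hu : u ∈ Hm) (hsrc : csources G Λ n = {x} ∆ {θ u}) : h.ConnFix (h.fold n) u := by
  rw [← fold_creflect h n]
  refine h.connFix_fold_of_sources (h.creflect n) hu fun v hv => ?_
  rw [h.csources_creflect, hsrc, Finset.image_symmDiff _ _ θ.injective, image_singleton, image_singleton, h.invol u]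
  have hvx : v ≠ θ x := fun hvx => h.left_disjoint x hx (hvx ▸ hv)
  simp only [mem_symmDiff, mem_singleton]
  constructor
  · rintro (⟨h1, -⟩ | ⟨h1, -⟩)
    exacts [absurd h1 hvx, h1]
  · exact fun h1 => Or.inr ⟨h1, hvx⟩

/-- **Inserting the indicator for free**: for `x, u ∈ H₋`,
`Z_{E'}({x} ∆ {θu}) = Z^{{x} ∆ {θu}}_{E'}[u ⟷ 𝕏 in fold n]` (every current with these sources connects `u` to the mirror
plane in the fold, `connFix_fold_of_csources_eq`). [cite: DuminilCopinPanis2025LowerBounds, Lemma 2.4 (proof)] -/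
theorem currentZ_eq_tsum_connFix (h : IsFoldable G θ Λ Hm) (β : ℝ) (E' : Finset (Sym2 V)) {x u : V} (hx : x ∈ Hm)
    (hu : u ∈ Hm) :
    currentZ G Λ β E' ({x} ∆ {θ u}) =
      ∑' n : edgesIn G Λ → ℕ, ind (csources G Λ n = {x} ∆ {θ u} ∧ CSupp G Λ E' n) * cweight G Λ β n *
        ind (h.ConnFix (h.fold n) u) := by
  unfold currentZ
  refine tsum_congr fun n => ?_
  by_cases hc : csources G Λ n = {x} ∆ {θ u} ∧ CSupp G Λ E' n
  · rw [ind_of_true (connFix_fold_of_csources_eq h hx hu hc.1), mul_one]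
  · rw [ind_of_false hc, zero_mul, zero_mul]

/-- **The folded identity in generating-function form** (Aizenman 2025, Thm 14.2 / Lemma 14.3; DCP 2025, Lemma 2.3 at the
vertex `u`): for `x, u ∈ H₋` and `β ≥ 0`,
`Z({x} ∆ {θu}) = Z^{{x} ∆ {u}}[u ⟷ 𝕏 in fold n]` on the bonds `ℰ_Λ` of the volume.
[cite: DuminilCopinPanis2025LowerBounds, Lemma 2.3] -/
theorem currentZ_singleton_symmDiff_reflect_eq (h : IsFoldable G θ Λ Hm) {β : ℝ} (hβ : 0 ≤ β) {x u : V}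
    (hx : x ∈ Hm) (hu : u ∈ Hm) :
    currentZ G Λ β (edgesIn G Λ) ({x} ∆ {θ u}) =
      ∑' n : edgesIn G Λ → ℕ, ind (csources G Λ n = {x} ∆ {u} ∧ CSupp G Λ (edgesIn G Λ) n) * cweight G Λ β n *
        ind (h.ConnFix (h.fold n) u) := by
  have hE' : ∀ e ∈ edgesIn G Λ, e ∈ edgesIn G Λ ↔ Sym2.map θ e ∈ edgesIn G Λ :=
    fun e he => ⟨fun _ => h.map_mem_edgesIn he, fun _ => he⟩
  rw [currentZ_eq_tsum_connFix h β (edgesIn G Λ) hx hu, h.tsum_switch_reflected_eq ({x} ∆ {θ u}) hE' hu hβ]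
  -- symmetric-difference algebra: `({x} ∆ {θu}) ∆ ({u} ∆ {θu}) = {x} ∆ {u}`
  have key : (({x} : Finset V) ∆ {θ u}) ∆ ({u} ∆ {θ u}) = {x} ∆ {u} := by
    rw [symmDiff_comm ({u} : Finset V) {θ u}, symmDiff_assoc, symmDiff_symmDiff_cancel_left]
  rw [key]

end FoldDatum

/-! ## Part B. The identity on the box -/

/-- Real-variable bookkeeping for the ratio: if `0 ≤ F ≤ Zxy` then `F / Z₀ = (Zxy / Z₀) · (F / Zxy)` (the case
`Zxy = 0` forces `F = 0`, where both sides vanish with Lean's `x / 0 = 0`). [folklore] -/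
theorem div_eq_div_mul_div_of_le {F Zxy : ℝ} (Z₀ : ℝ) (hF : 0 ≤ F) (hle : F ≤ Zxy) :
    F / Z₀ = Zxy / Z₀ * (F / Zxy) := by
  rcases eq_or_ne Zxy 0 with h0 | h0
  · have hF0 : F = 0 := le_antisymm (h0 ▸ hle) hF
    rw [hF0, h0, zero_div, zero_div, zero_mul]
  · rw [div_mul_div_comm, mul_comm Zxy F, mul_div_mul_right _ _ h0]

/-- **The core of F1 in current form**: for `x, y ∈ Λ_L` strictly left of `𝕏`,
`Z_{Λ_L}({x} ∆ {θy}) = Z^{xy}_{Λ_L}[y ⟷ 𝕏 in n + θ(n)] = foldHitZ L β x y`.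
[cite: Aizenman2025GeometricIII, Thm 14.2 and Lemma 14.3] -/
theorem currentZ_mirror_eq_foldHitZ (L : ℕ) {β : ℝ} (hβ : 0 ≤ β) {x y : Site 3} (hx : x ∈ leftHalf L)
    (hy : y ∈ leftHalf L) :
    currentZ (zdGraph 3) (box 3 L) β (edgesIn (zdGraph 3) (box 3 L)) ({x} ∆ {mirror y}) = foldHitZ L β x y := by
  rw [currentZ_singleton_symmDiff_reflect_eq (isFoldable_box L) hβ hx hy]
  rfl

/-- **F1 — Aizenman's folded random-current identity on the box** (M. Aizenman, *Geometric analysis of Ising models,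
Part III*, arXiv:2509.02850, Thm 14.2 with Lemma 14.3, free boundary condition on `Λ_L`): for `β ≥ 0` and
`x, y ∈ Λ_L` with `x₀, y₀ < 0`, `⟨σ_x σ_{θy}⟩^∅_{Λ_L,β} = ⟨σ_x σ_y⟩^∅_{Λ_L,β} · P^{xy}_{Λ_L,β}[y ⟷ 𝕏 in n + θ(n)]`.
The registered stub `stub_foldedIdentity` of line `folded-current-repulsion`.
[cite: Aizenman2025GeometricIII, Thm 14.2 and Lemma 14.3] -/
theorem stub_foldedIdentity : FoldedIdentity := by
  intro L β hβ x y hx hy hx0 hy0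
  have hxH : x ∈ leftHalf L := mem_leftHalf.2 ⟨hx, hx0⟩
  have hyH : y ∈ leftHalf L := mem_leftHalf.2 ⟨hy, hy0⟩
  have hθy : mirror y ∈ box 3 L := (mirror_mem_box_iff L y).2 hy
  have hA : ({x} : Finset (Site 3)) ∆ {mirror y} ⊆ box 3 L :=
    Finset.symmDiff_subset_union.trans (union_subset (singleton_subset_iff.2 hx) (singleton_subset_iff.2 hθy))
  have hB : ({x} : Finset (Site 3)) ∆ {y} ⊆ box 3 L :=
    Finset.symmDiff_subset_union.trans (union_subset (singleton_subset_iff.2 hx) (singleton_subset_iff.2 hy))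
  rw [isingTwoPoint_eq_isingCorr_symmDiff, isingTwoPoint_eq_isingCorr_symmDiff,
    isingCorr_free_eq_currentZ_div (Λ := box 3 L) hβ subset_rfl hA,
    isingCorr_free_eq_currentZ_div (Λ := box 3 L) hβ subset_rfl hB, currentZ_mirror_eq_foldHitZ L hβ hxH hyH]
  unfold foldHitProb
  exact div_eq_div_mul_div_of_le _ ENNReal.toReal_nonneg
    (ENNReal.toReal_mono (currentZ_edgesIn_ne_top hβ subset_rfl _) (foldHitZ_le_currentZ L β x y))

end Summit.CriticalPhenomena.Ising3DConformalLimit.Cruxes.ExistsScaleCovariantLimit.FoldedCurrentRepulsion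

end
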